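import Literature.Computability.MetaComplexity.MCSPUniversalInverter
import Literature.Computability.Cryptography.OracleAdversaryFPRel
import Literature.Computability.Complexity.OracleClosure
import Literature.Computability.Complexity.BrickAlgebra
import Literature.Computability.Complexity.StringEquality
import Literature.Computability.Complexity.FinitePatching
import HarnessLib

/-!
# `MCSP` as a universal inverter: patching an inverter at small lengths (proofs)

Sibling proof file of `MCSPUniversalInverter.lean` (the named fact
`AllenderEtAl2006_MCSP_universalInverter`, Allender–Buhrman–Koucký–van Melkebeek–Ronneburger
2006, Thm. 45 with §4.2). Theorem 45 promises an inverter `N^L` with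
`Pr_{|x| = n, s}[f(y, N^L(y, f(y,x), s)) = f(y,x)] ≥ 1/q(n)` for ANY `n`, whereas its printed
proof (p. 24 of the author version: "`L` is a statistical test that accepts many random strings of
length `|x|^{O(1)}`, but rejects all pseudorandom strings") is asymptotic — the density of `L` and
the circuit-size estimate of the stretched generator only hold for all sufficiently large `n`. The
gap is closed by the routine remark that a uniform machine may be modified on finitely many input
lengths (Arora–Barak 2009, §1.3/§6.2; here: for `n < n₀` there are finitely many instances
`(y, f(y, x))` with `|y| ≤ r(n)`, and a preimage for each can be hard-wired). This file proves
that remark for the tree's PPT oracle adversaries, without building a machine: the clocked run of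
an adversary is an `FP^A` function (`OracleAdversary.clockedRun_mem_FPRel`), post-processing it
by an `FP` function stays in `FP^A` (`postPre_mem_FPRel`), and the post-processing "keep the
candidate if it is a preimage, else consult a finite table" is in `FP` by the brick algebra
(`iteFn`, `eqPairFn`, `fanoutFn`, `fstF`/`sndF`) and finite patching (`mem_FP_of_eqOn_le`).
Theorems only (the post-processing map is a local definition of the proof).

* `outputPMF_toOuterMeasure_le_of_imp`, `outputPMF_toOuterMeasure_eq_one_of_forall` — comparing
  / evaluating the probability of an event of outputs coin string by coin string;
* `exists_patched_inverter` — for `F ∈ FP`, a language `A`, a PPT adversary `N` and a bound `W₀`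
  there is a PPT adversary `N''` that inverts `f_y` at `x` with probability at least that of `N`
  for every `(y, x)`, and with probability `1` whenever `|⟨y, f_y(x)⟩| < W₀`;
* `UniversalAvgInverter.of_eventually` — **it suffices to invert at all sufficiently large
  lengths**: if for every `F`, `r` some PPT `N^A` achieves `≥ 1/q(n)` for all `n ≥ n₀` and all
  `|y| ≤ r(n)`, then `A` is a universal average-case inverter oracle (`UniversalAvgInverter`).

## References

* E. Allender, H. Buhrman, M. Koucký, D. van Melkebeek, D. Ronneburger, *Power from random
  strings*, SIAM J. Comput. 35(6) (2006) [AllenderEtAl2006]: Thm. 45 and its proof (pp. 23–24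
  of the author version).
* S. Arora, B. Barak, *Computational Complexity: A Modern Approach*, CUP 2009 [AroraBarak2009]:
  §1.3 (closure of polynomial time; hard-wiring finitely many inputs), Def. 7.1 with §3.4
  (probabilistic oracle machines as deterministic machines on random coins).
-/

noncomputable section

namespace Literature.Computability.MetaComplexity

open _root_.Computability Complexity Complexity.Brick Cryptography

/-! ### Events of outputs, coin string by coin string -/

/-- **Comparing an event of outputs coin string by coin string.** If `N'` has the same coin
budget as `N` and, on input `w`, for every coin string `r` of the right length the run of `N'^B`
on `⟨w, r⟩` lands in `S` whenever the run of `N^A` does, then `S` is at least as likely under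
`N'^B` as under `N^A` on input `w`. [folklore] [cite: AroraBarak2009, Def. 7.1] -/
theorem outputPMF_toOuterMeasure_le_of_imp {β : Type} {N N' : OracleAdversary β} {A B : Oracle}
    (hcoins : N'.coins = N.coins) (w : List Bool) {S : Set (Option β)}
    (h : ∀ r : List Bool, r.length = N.coins.eval w.length →
      N.alg.run A (N.fuel.eval w.length) (boolPair w r) ∈ S →
        N'.alg.run B (N'.fuel.eval w.length) (boolPair w r) ∈ S) :
    (N.outputPMF A w).toOuterMeasure S ≤ (N'.outputPMF B w).toOuterMeasure S := by
  obtain ⟨alg', coins', fuel'⟩ := N'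
  dsimp only at hcoins h
  subst hcoins
  rw [OracleAdversary.outputPMF_eq_map, OracleAdversary.outputPMF_eq_map,
    PMF.toOuterMeasure_map_apply, PMF.toOuterMeasure_map_apply]
  refine PMF.toOuterMeasure_mono _ fun r hr => ?_
  simp only [Set.mem_inter_iff, Set.mem_preimage] at hr ⊢
  exact h r.toList (by simp) hr.1

/-- **An event met by every coin string has probability one.** [folklore]
[cite: AroraBarak2009, Def. 7.1] -/
theorem outputPMF_toOuterMeasure_eq_one_of_forall {β : Type} (N : OracleAdversary β) (O : Oracle)
    (w : List Bool) {S : Set (Option β)}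
    (h : ∀ r : List Bool, r.length = N.coins.eval w.length →
      N.alg.run O (N.fuel.eval w.length) (boolPair w r) ∈ S) :
    (N.outputPMF O w).toOuterMeasure S = 1 := by
  rw [OracleAdversary.outputPMF_eq_map, PMF.toOuterMeasure_apply_eq_one_iff, PMF.support_map]
  rintro _ ⟨r, -, rfl⟩
  exact h r.toList (by simp)

/-! ### The patched inverter -/

/-- **Patching an inverter at short instances.** For `F ∈ FP`, a language `A`, a PPT oracle
adversary `N` and a bound `W₀` there is a PPT oracle adversary `N''` (same coin budget) such that
(i) for every `(y, x)` the probability that `N''^A` inverts `f_y` at `x` is at least that of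
`N^A`, and (ii) it is `1` whenever the instance `⟨y, f_y(x)⟩` is shorter than `W₀`. Construction:
post-process the clocked run of `N` (an `FP^A` function of `⟨input, coins⟩`,
`OracleAdversary.clockedRun_mem_FPRel`) by "verify, else consult a finite preimage table"
(`postPre_mem_FPRel`; the map is in `FP` by `iteFn`, `eqPairFn`, `mem_FP_of_eqOn_le`); the resulting
`FP^A` machine, run for `q(2|w| + 2 + coins |w|)` rounds, is `N''`. On every coin string, a
successful candidate of `N` is kept, and on a short instance a failed candidate is replaced by a
hard-wired preimage (which exists, `f_y(x)` being in the image of `f_y`).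
[cite: AllenderEtAl2006, Thm. 45 ("for any n")] [cite: AroraBarak2009, §1.3] -/
theorem exists_patched_inverter {F : List Bool → List Bool} (hF : F ∈ FP) (A : Language Bool)
    (N : OracleAdversary (List Bool)) (hN : N.IsPPT (encodingList Bool)) (W₀ : ℕ) :
    ∃ N'' : OracleAdversary (List Bool), N''.IsPPT (encodingList Bool) ∧
      (∀ y x : List Bool, oracleInvertProbAt F N (Oracle.ofLanguage A) y x ≤
        oracleInvertProbAt F N'' (Oracle.ofLanguage A) y x) ∧
      (∀ y x : List Bool, (boolPair y (F (boolPair y x))).length < W₀ →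
        oracleInvertProbAt F N'' (Oracle.ofLanguage A) y x = 1) := by
  classical
  set O := Oracle.ofLanguage A with hO
  /- The post-processing map `post`: on `p = ⟨⟨⟨y, z⟩, r⟩, v⟩` (machine input `⟨y, z⟩`, coins
  `r`, candidate `v`) output `v` if `F ⟨y, v⟩ = z` (the bit `vbit p = eqPairFn ⟨F ⟨y, v⟩, z⟩`),
  else the entry at `⟨y, z⟩` of the finite table `table` (a preimage, hard-wired for the inputs
  shorter than `W₀`; `pre` is a noncomputable total choice of preimages, never computed). -/
  let pre : List Bool → List Bool := fun w =>
    if h : ∃ x' : List Bool, F (boolPair (fstF w) x') = sndF w then h.choose else []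
  let table : List Bool → List Bool := fun w => if w.length < W₀ then pre w else []
  let vbit : List Bool → List Bool :=
    eqPairFn ∘ fanoutFn (F ∘ fanoutFn (fstF ∘ fstF ∘ fstF) sndF) (sndF ∘ fstF ∘ fstF)
  let post : List Bool → List Bool := iteFn vbit sndF (table ∘ fstF ∘ fstF)
  have hpre : ∀ y z : List Bool, (∃ x' : List Bool, F (boolPair y x') = z) →
      F (boolPair y (pre (boolPair y z))) = z := by
    intro y z h
    have h' : ∃ x' : List Bool, F (boolPair (fstF (boolPair y z)) x') = sndF (boolPair y z) := by
      simpa using h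
    have he : pre (boolPair y z) = h'.choose := dif_pos h'
    rw [he]
    simpa using h'.choose_spec
  have hpost_apply : ∀ y z r v : List Bool,
      post (boolPair (boolPair (boolPair y z) r) v) =
        if F (boolPair y v) = z then v else table (boolPair y z) := by
    intro y z r v
    have hb : vbit (boolPair (boolPair (boolPair y z) r) v) = [decide (F (boolPair y v) = z)] := by
      simp [vbit, eqPairFn_boolPair]
    simp only [post]
    rw [iteFn_apply hb]
    by_cases h : F (boolPair y v) = z <;> simp [h]
  -- `post ∈ FP` by the brick algebra and finite patching
  have htable : table ∈ FP :=
    mem_FP_of_eqOn_le (const_mem_FP []) W₀ fun z hz => by simp [table, Nat.not_lt.2 hz]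
  have h2 : (fstF ∘ fstF : List Bool → List Bool) ∈ FP :=
    comp_mem_FP (g := fstF) (f := fstF) fstF_mem_FP fstF_mem_FP
  have h3 : (fstF ∘ fstF ∘ fstF : List Bool → List Bool) ∈ FP :=
    comp_mem_FP (g := fstF) (f := fstF ∘ fstF) fstF_mem_FP h2
  have hz : (sndF ∘ fstF ∘ fstF : List Bool → List Bool) ∈ FP :=
    comp_mem_FP (g := sndF) (f := fstF ∘ fstF) sndF_mem_FP h2
  have hyv : (F ∘ fanoutFn (fstF ∘ fstF ∘ fstF) sndF : List Bool → List Bool) ∈ FP :=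
    comp_mem_FP (g := F) (f := fanoutFn (fstF ∘ fstF ∘ fstF) sndF) hF
      (fanoutFn_mem_FP h3 sndF_mem_FP)
  have hvbit : vbit ∈ FP :=
    comp_mem_FP (g := eqPairFn) (f := fanoutFn (F ∘ fanoutFn (fstF ∘ fstF ∘ fstF) sndF)
      (sndF ∘ fstF ∘ fstF)) eqPairFn_mem_FP (fanoutFn_mem_FP hyv hz)
  have ht : (table ∘ fstF ∘ fstF : List Bool → List Bool) ∈ FP :=
    comp_mem_FP (g := table) (f := fstF ∘ fstF) htable h2
  have hpost : post ∈ FP := iteFn_mem_FP hvbit sndF_mem_FP ht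
  -- the clocked run of `N`, post-processed, is an `FP^A` function; its machine is `N''`
  set f : List Bool → List Bool :=
    fun w => (N.alg.run O (N.fuel.eval (boolUnpair w).1.length) w).getD [] with hf
  have hfmem : f ∈ FPRel O := OracleAdversary.clockedRun_mem_FPRel N hN A
  have hid : (id : List Bool → List Bool) ∈ FP := PolyTimeComputable.id _
  obtain ⟨C, hC, q, hCrun⟩ := postPre_mem_FPRel hfmem hid hpost
  let N'' : OracleAdversary (List Bool) := ⟨C, N.coins, q.comp (2 * Polynomial.X + 2 + N.coins)⟩
  -- the run of `N''` on a genuine input-and-coins pair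
  have hrun : ∀ w r : List Bool, r.length = N.coins.eval w.length →
      N''.alg.run O (N''.fuel.eval w.length) (boolPair w r) =
        some (post (boolPair (boolPair w r)
          ((N.alg.run O (N.fuel.eval w.length) (boolPair w r)).getD []))) := by
    intro w r hr
    have hlen : (boolPair w r).length = 2 * w.length + 2 + N.coins.eval w.length := by
      rw [length_boolPair, hr]
    have h1 := (hCrun (boolPair w r)).1
    rw [hlen] at h1
    have hfuel : (q.comp (2 * Polynomial.X + 2 + N.coins)).eval w.length =
        q.eval (2 * w.length + 2 + N.coins.eval w.length) := by
      simp [Polynomial.eval_comp]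
    change C.run O ((q.comp (2 * Polynomial.X + 2 + N.coins)).eval w.length) (boolPair w r) = _
    rw [hfuel, h1]
    simp [hf, boolUnpair_boolPair]
  refine ⟨N'', hC, fun y x => ?_, fun y x hW => ?_⟩
  · -- (i) a successful candidate of `N` is kept
    unfold oracleInvertProbAt
    set S : Set (Option (List Bool)) :=
      {o | ∃ w, o = some w ∧ F (boolPair y w) = F (boolPair y x)} with hS
    set w := boolPair y (F (boolPair y x)) with hw
    have hle : (N.outputPMF O w).toOuterMeasure S ≤ (N''.outputPMF O w).toOuterMeasure S := by
      refine outputPMF_toOuterMeasure_le_of_imp (N := N) (N' := N'') rfl w fun r hr hmem => ?_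
      obtain ⟨v, hv, hFv⟩ := hmem
      refine ⟨v, ?_, hFv⟩
      rw [hrun w r hr, hv, hw]
      simp [hpost_apply, hFv]
    refine ENNReal.toReal_mono (ne_top_of_le_ne_top ENNReal.one_ne_top ?_) hle
    set μ := (N''.outputPMF O w).toOuterMeasure
    calc μ S ≤ μ Set.univ := μ.mono (Set.subset_univ _)
      _ = 1 := (PMF.toOuterMeasure_apply_eq_one_iff _ _).2 (Set.subset_univ _)
  · -- (ii) on a short instance every coin string succeeds
    unfold oracleInvertProbAt
    set S : Set (Option (List Bool)) :=
      {o | ∃ w, o = some w ∧ F (boolPair y w) = F (boolPair y x)} with hS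
    set w := boolPair y (F (boolPair y x)) with hw
    have hone : (N''.outputPMF O w).toOuterMeasure S = 1 := by
      refine outputPMF_toOuterMeasure_eq_one_of_forall N'' O w fun r hr => ?_
      rw [hrun w r hr, hw]
      refine ⟨_, rfl, ?_⟩
      rw [hpost_apply]
      split_ifs with hv
      · exact hv
      · have htab : table (boolPair y (F (boolPair y x))) = pre (boolPair y (F (boolPair y x))) :=
          if_pos (hw ▸ hW)
        rw [htab]
        exact hpre y _ ⟨x, rfl⟩
    rw [hone, ENNReal.toReal_one]

/-! ### It suffices to invert at all sufficiently large lengths -/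

/-- The uniform average of a function equal to `1` on `{0,1}ⁿ` is `1`. [folklore] -/
private theorem uniformAvg_eq_one {n : ℕ} {g : List Bool → ℝ}
    (h : ∀ x : List Bool, x.length = n → g x = 1) : uniformAvg n g = 1 := by
  unfold uniformAvg
  rw [Finset.sum_congr rfl fun (v : List.Vector Bool n) _ => h v.toList v.toList_length]
  simp [card_vector]

/-- Monotonicity of the uniform average on `{0,1}ⁿ`. [folklore] -/
private theorem uniformAvg_mono_on {n : ℕ} {f g : List Bool → ℝ}
    (h : ∀ x : List Bool, x.length = n → f x ≤ g x) : uniformAvg n f ≤ uniformAvg n g := by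
  unfold uniformAvg
  exact div_le_div_of_nonneg_right
    (Finset.sum_le_sum fun (v : List.Vector Bool n) _ => h v.toList v.toList_length) (by positivity)

/-- **It suffices to invert at all sufficiently large lengths** (the "for any `n`" of ABK⁺06
Thm. 45 from its asymptotic proof). Suppose that for every `F ∈ FP` with length-preserving
sections and every polynomial `r` there are a PPT oracle adversary `N`, a positive polynomial `q`
and a threshold `n₀` with `Pr_{|x| = n, s}[f(y, N^A(y, f(y,x), s)) = f(y,x)] ≥ 1/q(n)` for all
`n ≥ n₀` and all `|y| ≤ r(n)`. Then `A` is a universal average-case inverter oracle: patch `N` at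
the finitely many short instances (`exists_patched_inverter` with
`W₀ = 1 + max_{n < n₀} (2 r(n) + 2 + n)`), after which the bound `1/q(n) ≤ 1` holds at every
`n < n₀` too. [cite: AllenderEtAl2006, Thm. 45 ("for any n and y")] [cite: AroraBarak2009, §1.3] -/
theorem UniversalAvgInverter.of_eventually {A : Language Bool}
    (h : ∀ (F : List Bool → List Bool) (r : Polynomial ℕ), F ∈ FP →
      (∀ y x : List Bool, (F (boolPair y x)).length = x.length) →
      ∃ (N : OracleAdversary (List Bool)) (q : Polynomial ℕ) (n₀ : ℕ),
        N.IsPPT (encodingList Bool) ∧ (∀ n, 0 < q.eval n) ∧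
        ∀ (n : ℕ) (y : List Bool), n₀ ≤ n → y.length ≤ r.eval n →
          (1 : ℝ) / ((q.eval n : ℕ) : ℝ) ≤ oracleInvertProb F N (Oracle.ofLanguage A) y n) :
    UniversalAvgInverter (Oracle.ofLanguage A) := by
  intro F r hF hlen
  obtain ⟨N, q, n₀, hN, hq, hbound⟩ := h F r hF hlen
  set W₀ : ℕ := (Finset.range n₀).sup (fun n => 2 * r.eval n + 2 + n) + 1 with hW₀
  obtain ⟨N'', hN'', hdom, hshort⟩ := exists_patched_inverter hF A N hN W₀
  refine ⟨N'', q, hN'', hq, fun n y hy => ?_⟩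
  by_cases hn : n₀ ≤ n
  · exact (hbound n y hn hy).trans (uniformAvg_mono_on fun x _ => hdom y x)
  · -- a short instance: success probability one
    have hlt : n < n₀ := Nat.lt_of_not_le hn
    have hsup : 2 * r.eval n + 2 + n ≤ (Finset.range n₀).sup (fun n => 2 * r.eval n + 2 + n) :=
      Finset.le_sup (f := fun n => 2 * r.eval n + 2 + n) (Finset.mem_range.2 hlt)
    have hone : oracleInvertProb F N'' (Oracle.ofLanguage A) y n = 1 := by
      refine uniformAvg_eq_one fun x hx => hshort y x ?_
      rw [length_boolPair, hlen, hx]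
      omega
    rw [hone]
    have hq1 : (1 : ℝ) ≤ ((q.eval n : ℕ) : ℝ) := by exact_mod_cast hq n
    exact (div_le_one (by positivity)).2 hq1

end Literature.Computability.MetaComplexity
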